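import Mathlib
import Summits.RiemannHypothesis.RiemannHypothesis.Theorems.WeilGroundStateArchimedeanWindowSimpleEvenTrial3
import HarnessLib

/-!
# Stub `stub_archTailLogTwo` — the archimedean tail constant at the top window
(crux `WeilParity.EvenWinsArch`, stmt-RiemannHypothesis-15433, line `birth`)

`T(x) = ∫_x^∞ ρ(t) dt` is the tail of the archimedean jump density
`ρ(t) = e^{t/2}/(2 sinh t) = e^{-t/2}/(1 − e^{-2t})` (`weilArchDensity`). At `x = log 2` everything is
exact: `T(log 2) = √2 Σ_{k ≥ 0} 4^{-k}/(4k+1) = 1.4968533…`, and we prove `T(log 2) ≤ 1.49686`.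

Proof (template: the tree's `setIntegral_Ioi_weilArchDensity_le`). For `t ≥ log 2` put `q = e^{-2t} ≤ 1/4`;
the finite geometric expansion `1/(1 − q) = Σ_{k<8} q^k + q⁸/(1 − q)` gives
`ρ(t) ≤ Σ_{k<8} e^{-(2k+1/2)t} + e^{-(33/2)t}/(1 − 1/4)`; integrate termwise over `(log 2, ∞)`
(`integral_exp_mul_Ioi`), evaluate the nodes `e^{-(2k+1/2) log 2} = e^{-(log 2)/2} · 4^{-k}` exactly,
bound `e^{-(log 2)/2} = 1/√2 ≤ 7071068/10⁷` (its square is `1/2 ≤ (7071068/10⁷)²`), and finish with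
`norm_num` (margin `6.6 · 10⁻⁶`).
-/

noncomputable section

set_option linter.dupNamespace false

open MeasureTheory Set Filter

namespace Summit.RiemannHypothesis.RiemannHypothesis.Theorems.WeilParity.EvenWinsArch

open Literature.NumberTheory.LFunctions
open Summit.RiemannHypothesis.RiemannHypothesis.Theorems.WeilGroundState

/-- `e^{-log 2} = 1/2`. [folklore] -/
theorem exp_neg_log_two : Real.exp (-Real.log 2) = 1 / 2 := by
  rw [Real.exp_neg, Real.exp_log two_pos, one_div]

/-- `e^{-2t} ≤ 1/4` for `t ≥ log 2`. [folklore] -/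
theorem exp_neg_two_mul_le_quarter {t : ℝ} (ht : Real.log 2 ≤ t) :
    Real.exp (-(2 * t)) ≤ 1 / 4 := by
  calc Real.exp (-(2 * t)) ≤ Real.exp (-(2 * Real.log 2)) := Real.exp_le_exp.2 (by linarith)
    _ = Real.exp (-Real.log 2) ^ 2 := by
        rw [← Real.exp_nat_mul]; congr 1; push_cast; ring
    _ = 1 / 4 := by rw [exp_neg_log_two]; norm_num

/-- `e^{-(log 2)/2} = 1/√2 ≤ 7071068/10⁷` (compare squares: `1/2 ≤ (7071068/10⁷)²`). [folklore] -/
theorem exp_neg_half_log_two_le : Real.exp (-(Real.log 2 / 2)) ≤ 7071068 / 10000000 := by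
  have hsq : Real.exp (-(Real.log 2 / 2)) ^ 2 = 1 / 2 := by
    rw [← Real.exp_nat_mul]
    have h : ((2 : ℕ) : ℝ) * (-(Real.log 2 / 2)) = -Real.log 2 := by push_cast; ring
    rw [h, exp_neg_log_two]
  have hpos : 0 < Real.exp (-(Real.log 2 / 2)) := Real.exp_pos _
  rw [← pow_le_pow_iff_left₀ hpos.le (by norm_num) two_ne_zero, hsq]
  norm_num

/-- The nodes at `log 2`: `e^{-(2k+1/2) log 2} = e^{-(log 2)/2} · (1/4)^k`. [folklore] -/
theorem exp_node_log_two (k : ℕ) :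
    Real.exp (-(2 * (k : ℝ) + 1 / 2) * Real.log 2) = Real.exp (-(Real.log 2 / 2)) * (1 / 4) ^ k := by
  have h4 : (1 / 4 : ℝ) = Real.exp (-Real.log 2) ^ 2 := by rw [exp_neg_log_two]; norm_num
  rw [h4, ← pow_mul, ← Real.exp_nat_mul, ← Real.exp_add]
  congr 1; push_cast; ring

/-- The archimedean density as a finite geometric sum plus a controlled tail on the top window:
for `t ≥ log 2`, `ρ(t) ≤ Σ_{k<8} e^{-(2k+1/2)t} + e^{-(33/2)t}/(1 − 1/4)` (`e^{-2t} ≤ 1/4`). [folklore] -/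
theorem weilArchDensity_le_geom_log_two {t : ℝ} (ht : Real.log 2 ≤ t) :
    weilArchDensity t ≤
      ∑ k ∈ Finset.range 8, Real.exp (-(2 * (k : ℝ) + 1 / 2) * t) +
        Real.exp (-(33 / 2) * t) / (1 - (1 / 4 : ℝ)) := by
  set q : ℝ := Real.exp (-(2 * t)) with hq
  have hq0 : 0 < q := Real.exp_pos _
  have hqQ : q ≤ 1 / 4 := exp_neg_two_mul_le_quarter ht
  have h1q : 0 < 1 - q := by linarith
  rw [weilArchDensity_eq t, ← hq]
  -- 1/(1 − q) = Σ_{k<8} q^k + q^8/(1 − q)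
  have hgeom : 1 / (1 - q) = ∑ k ∈ Finset.range 8, q ^ k + q ^ 8 / (1 - q) := by
    have h := geom_sum_mul_neg q 8
    field_simp
    linarith
  have he0 : 0 < Real.exp (-(t / 2)) := Real.exp_pos _
  rw [div_eq_mul_one_div, hgeom, mul_add, Finset.mul_sum]
  refine add_le_add (le_of_eq (Finset.sum_congr rfl fun k _ ↦ ?_)) ?_
  · rw [hq, ← Real.exp_nat_mul, ← Real.exp_add]
    congr 1; ring
  · have h2 : Real.exp (-(t / 2)) * (q ^ 8 / (1 - q)) ≤
        Real.exp (-(t / 2)) * (q ^ 8 / (1 - (1 / 4 : ℝ))) := by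
      refine mul_le_mul_of_nonneg_left ?_ he0.le
      exact div_le_div_of_nonneg_left (by positivity) (by norm_num) (by linarith)
    refine h2.trans (le_of_eq ?_)
    rw [hq, ← Real.exp_nat_mul, mul_div_assoc', ← Real.exp_add]
    congr 2; push_cast; ring

/-- **Stub T6 — the tail constant at the top window.**
`T(log 2) = ∫_{log 2}^∞ e^{t/2}/(2 sinh t) dt = √2 Σ_k 4^{-k}/(4k+1) = 1.496853… ≤ 1.49686`
(eight-term geometric expansion of `ρ` with the tail `e^{-(33/2)t}/(1 − 1/4)` on `t ≥ log 2`,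
termwise integration, exact nodes `e^{-(log 2)/2} 4^{-k}` and `e^{-(log 2)/2} ≤ 7071068/10⁷`). [folklore] -/
theorem stub_archTailLogTwo :
    ∫ t in Set.Ioi (Real.log 2), Literature.NumberTheory.LFunctions.weilArchDensity t ≤ 1.49686 := by
  set c : ℝ := Real.exp (-(Real.log 2 / 2)) with hc
  set G : ℝ → ℝ := fun t ↦ ∑ k ∈ Finset.range 8, Real.exp (-(2 * (k : ℝ) + 1 / 2) * t) +
    Real.exp (-(33 / 2) * t) / (1 - (1 / 4 : ℝ)) with hG
  have hs : MeasurableSet (Ioi (Real.log 2)) := measurableSet_Ioi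
  have hak : ∀ k : ℕ, -(2 * (k : ℝ) + 1 / 2) < 0 := fun k ↦ by
    have : (0 : ℝ) ≤ k := Nat.cast_nonneg k
    linarith
  have hik : ∀ k : ℕ,
      IntegrableOn (fun t ↦ Real.exp (-(2 * (k : ℝ) + 1 / 2) * t)) (Ioi (Real.log 2)) :=
    fun k ↦ integrableOn_exp_mul_Ioi (hak k) _
  have hi33 : IntegrableOn (fun t ↦ Real.exp (-(33 / 2) * t) / (1 - (1 / 4 : ℝ))) (Ioi (Real.log 2)) :=
    (integrableOn_exp_mul_Ioi (by norm_num) _).div_const _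
  have hGi : IntegrableOn G (Ioi (Real.log 2)) := by
    rw [hG]
    exact (integrable_finsetSum _ fun k _ ↦ hik k).add hi33
  have hlog2 : 0 < Real.log 2 := Real.log_pos one_lt_two
  have hbd : ∀ t ∈ Ioi (Real.log 2), 0 ≤ weilArchDensity t ∧ weilArchDensity t ≤ G t := by
    intro t ht
    have ht' : Real.log 2 < t := ht
    exact ⟨(weilArchDensity_pos (by linarith)).le, weilArchDensity_le_geom_log_two ht'.le⟩
  have hρi : IntegrableOn weilArchDensity (Ioi (Real.log 2)) := by
    refine Integrable.mono' hGi measurable_weilArchDensity'.aestronglyMeasurable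
      ((ae_restrict_iff' hs).2 (Eventually.of_forall fun t ht ↦ ?_))
    obtain ⟨h0, h1⟩ := hbd t ht
    rw [Real.norm_of_nonneg h0]
    exact h1
  have hint : ∫ t in Ioi (Real.log 2), G t =
      ∑ k ∈ Finset.range 8,
          Real.exp (-(2 * (k : ℝ) + 1 / 2) * Real.log 2) / (2 * (k : ℝ) + 1 / 2) +
        Real.exp (-(33 / 2) * Real.log 2) / (33 / 2) / (1 - (1 / 4 : ℝ)) := by
    rw [hG]
    simp only
    rw [integral_add (integrable_finsetSum _ fun k _ ↦ hik k) hi33,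
      integral_finsetSum _ fun k _ ↦ hik k]
    congr 1
    · refine Finset.sum_congr rfl fun k _ ↦ ?_
      rw [integral_exp_mul_Ioi (hak k)]
      have : (2 * (k : ℝ) + 1 / 2) ≠ 0 := by linarith [hak k]
      field_simp
    · rw [integral_div, integral_exp_mul_Ioi (by norm_num)]
      congr 1
      field_simp
  have hS : ∫ t in Ioi (Real.log 2), G t =
      c * (∑ k ∈ Finset.range 8, (1 / 4 : ℝ) ^ k / (2 * (k : ℝ) + 1 / 2) +
        (1 / 4 : ℝ) ^ 8 / (33 / 2) / (1 - (1 / 4 : ℝ))) := by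
    rw [hint, mul_add, Finset.mul_sum]
    congr 1
    · refine Finset.sum_congr rfl fun k _ ↦ ?_
      rw [exp_node_log_two k, hc]
      ring
    · have h8 : Real.exp (-(33 / 2) * Real.log 2) =
          Real.exp (-(2 * ((8 : ℕ) : ℝ) + 1 / 2) * Real.log 2) := by
        norm_num
      rw [h8, exp_node_log_two 8, hc]
      ring
  have hSnn : (0 : ℝ) ≤ ∑ k ∈ Finset.range 8, (1 / 4 : ℝ) ^ k / (2 * (k : ℝ) + 1 / 2) +
      (1 / 4 : ℝ) ^ 8 / (33 / 2) / (1 - (1 / 4 : ℝ)) := by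
    simp only [Finset.sum_range_succ, Finset.sum_range_zero]
    norm_num
  calc ∫ t in Ioi (Real.log 2), weilArchDensity t ≤ ∫ t in Ioi (Real.log 2), G t :=
        setIntegral_mono_on hρi hGi hs fun t ht ↦ (hbd t ht).2
    _ = _ := hS
    _ ≤ 7071068 / 10000000 * (∑ k ∈ Finset.range 8, (1 / 4 : ℝ) ^ k / (2 * (k : ℝ) + 1 / 2) +
          (1 / 4 : ℝ) ^ 8 / (33 / 2) / (1 - (1 / 4 : ℝ))) :=
        mul_le_mul_of_nonneg_right exp_neg_half_log_two_le hSnn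
    _ ≤ 1.49686 := by
        simp only [Finset.sum_range_succ, Finset.sum_range_zero]
        norm_num

end Summit.RiemannHypothesis.RiemannHypothesis.Theorems.WeilParity.EvenWinsArch

end
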